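import Literature.Computability.Complexity.GateEliminationQuadStep
import Literature.Computability.Complexity.GateEliminationCase54Leaves
import Literature.Computability.Complexity.GateEliminationCase81Dispatch

/-!
# Gate elimination: Case 5.4.1.4 of Li–Yang's Theorem 4.1 (the quadratic substitution), main line

The main line of Case 5.4.1.4 (ECCC TR21-023, §4.1): after the quadratic substitution
(`quadratic_step`: `D` replaced by the constant `kE`, `G` no longer troubled), "Eliminate `G` via
Rule 1 … Eliminate `E` via Rule 2, which again introduces no potential increment … Eliminate the
descendent of `D` via Rule 3 [no potential increment outside the hard cases] … Eliminate the
descendent of `E` via Rule 3, increasing the potential by at most `1`. … we can eliminate `5` gates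
with the net potential change `ΔΦ ≤ 0`, which guarantees `Δμ ≥ 5 - α_Q + α_I ≥ δ`."
PROVED here as `stepGoal_quadratic_aux`, with the hard sub-cases (Cases 5.4.1.4.1.1–4 and
5.4.1.4.2.1–5 of the paper, alternative substitution strategies) as explicit hypotheses, in the
local form used by the Case 5.4 dispatcher (hypothesis `hF6` of `LiYang2022_case5_4_holds_aux`).
Under the standing hypotheses (`Standing.and_fanout_le`), the paper's Case 5.4.1.4.1.2 cannot
occur and a trivialized descendant of `D` never creates a troubled gate.

## References

* J. Li, T. Yang, *3.1n − o(n) circuit lower bounds for explicit functions*, STOC 2022;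
  ECCC TR21-023, §2.4, §3.3, §4.1 (Case 5.4.1.4), Lemma 3.11.
-/

namespace Literature.Computability.Complexity

open Finset

/-- `δ ≤ α_I + (5 - α_Q)`. [cite: LiYang2022, Lemma 3.11 / proof of Thm. 1.1] -/
theorem liYangDelta_le_five_sub (αφ αI αQ : ℝ) : liYangDelta αφ αI αQ ≤ αI + (5 - αQ) := by
  unfold liYangDelta
  have : min (αI / 3) (min (2 - 2 * αφ + αQ) (min (4 - 4 * αφ) (min (3 + αφ) (min (5 - αQ) ((5 - 2 * αφ + αQ) / 2))))) ≤
      5 - αQ :=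
    (min_le_right _ _).trans ((min_le_right _ _).trans ((min_le_right _ _).trans ((min_le_right _ _).trans (min_le_left _ _))))
  linarith

namespace Semicircuit

variable {n : ℕ} {C : Semicircuit n} {f : (Fin n → ZMod 2) → Bool} {R : RdqSource n} {d : ℕ}
  {αφ αI αQ : ℝ} {G : Fin C.m} {x y : Fin n} {B C' D : Fin C.m} {aX aB aC aD : Fin 2}

/-- **Case 5.4.1.4 of the proof of Thm. 4.1** (the quadratic substitution), given its hard
sub-cases: `D` is not ∧-type, reads `G` and the unprotected `1`-variable `u`, and has two readers;
the ∧-type `1`-gate `E` reads `D` (at `aE`) and either a `2`-variable `t`, or the ⊕-type `B`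
reading a variable `t` with `fanout(t) + fanout(B) = 3`. The hypotheses `hQ11`–`hQ25` are the
paper's Cases 5.4.1.4.1.1, 1.3, 1.4, 2.1–2.5 (alternative substitution strategies).
[cite: LiYang2022, §4.1 (Case 5.4.1.4)] -/
theorem stepGoal_quadratic_aux (hf : IsAffineDisperser f d) (hd : 2 * d + 2 < R.dim) (hF : C.Fair)
    (hC : C.ComputesRestr f R) (hS : C.Standing R) (hcfg : C.Case5Config G x y B C' D aX aB aC aD)
    (hφ0 : 0 < αφ) (hI0 : 0 < αI) (hnDB : ¬ C.Reads D B)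
    {E : Fin C.m} {aE : Fin 2} {u : Fin n} (hDn : ¬ IsAndOp (C.op D)) (hIu : C.arg D aD.rev = .var u)
    (hup : ¬ R.Protected u) (hu1 : C.fanout (.var u) = 1) (hD2 : C.fanout (.gate D) = 2)
    (hEand : IsAndOp (C.op E)) (hED : C.arg E aE = .gate D) (hE1 : C.fanout (.gate E) = 1)
    (hEo : (∃ t, C.arg E aE.rev = .var t ∧ C.fanout (.var t) = 2) ∨
      (C.arg E aE.rev = .gate B ∧ ¬ IsAndOp (C.op B) ∧ ∃ t, C.arg B aB.rev = .var t ∧ C.fanout (.var t) + C.fanout (.gate B) = 3))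
    -- Case 5.4.1.4.1.1: `E` reads `B`, a `1`-gate
    (hQ11 : ∀ t, C.arg E aE.rev = .gate B → ¬ IsAndOp (C.op B) → C.arg B aB.rev = .var t → C.fanout (.gate B) = 1 →
      C.fanout (.var t) = 2 → C.StepGoal f R αφ αI αQ)
    -- Cases 5.4.1.4.1.3/4: `E` reads `B`, an ⊕-type `2`-gate reading the `1`-variable `t`
    (hQ13 : ∀ t, C.arg E aE.rev = .gate B → ¬ IsAndOp (C.op B) → C.arg B aB.rev = .var t → C.fanout (.gate B) = 2 →
      C.fanout (.var t) = 1 → C.StepGoal f R αφ αI αQ)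
    -- Case 5.4.1.4.2.1: the other reader `F` of `D` reads `t`
    (hQ21 : ∀ (t : Fin n) (F : Fin C.m) (aF : Fin 2), C.arg E aE.rev = .var t → C.fanout (.var t) = 2 → F ≠ E →
      C.arg F aF = .gate D → C.arg F aF.rev = .var t → C.StepGoal f R αφ αI αQ)
    -- Case 5.4.1.4.2.2: `F` is a `1`-gate reading a `2`-variable `u' ≠ t`
    (hQ22 : ∀ (t : Fin n) (F : Fin C.m) (aF : Fin 2) (u' : Fin n), C.arg E aE.rev = .var t → C.fanout (.var t) = 2 →
      F ≠ E → C.arg F aF = .gate D → C.arg F aF.rev = .var u' → u' ≠ t → C.fanout (.gate F) = 1 →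
      C.fanout (.var u') = 2 → ∀ (Y : Fin C.m) (aY : Fin 2) (v : Fin n), IsAndOp (C.op Y) → C.arg Y aY = .gate F →
      C.arg Y aY.rev = .var v → C.fanout (.gate Y) = 1 → C.fanout (.var v) = 2 → v ≠ u' → C.StepGoal f R αφ αI αQ)
    -- Cases 5.4.1.4.2.3–5: `F` is a `2`-gate reading a variable `u' ≠ t` that is a `1`-variable once `G` is gone
    (hQ23 : ∀ (t : Fin n) (F : Fin C.m) (aF : Fin 2) (u' : Fin n), C.arg E aE.rev = .var t → C.fanout (.var t) = 2 →
      F ≠ E → C.arg F aF = .gate D → C.arg F aF.rev = .var u' → u' ≠ t → C.fanout (.gate F) = 2 →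
      (C.fanout (.var u') = 1 ∨ u' = y) → C.StepGoal f R αφ αI αQ) :
    C.StepGoal f R αφ αI αQ := by
  classical
  have hφ' := hφ0.le
  have hI' := hI0.le
  have hN := hS.normalized.1
  -- `E` reads `B`: the alternatives of Case 5.4.1.4.1
  rcases hEo with ⟨t, hEt, hft⟩ | ⟨hEB, hBn, t, hBt, hsum⟩
  swap
  · have hB1 : 1 ≤ C.fanout (.gate B) := one_le_fanout_of_arg_eq hEB
    have ht1 : 1 ≤ C.fanout (.var t) := one_le_fanout_of_arg_eq hBt
    by_cases hB : C.fanout (.gate B) = 1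
    · exact hQ11 t hEB hBn hBt hB (by omega)
    · exact hQ13 t hEB hBn hBt (by omega) (by omega)
  -- `E` reads the `2`-variable `t`
  have hGK := hcfg.G_not_mem
  have hDK : D ∉ C.xorPart := fun hDK => hGK (C.mem_of_arg_eq D hDK aD G hcfg.arg_D)
  have hEK : E ∉ C.xorPart := C.not_mem_xorPart_of_isAndOp hEand
  have hED' : E ≠ D := fun h => by rw [h] at hED; exact C.arg_ne_self_of_not_mem hDK _ hED
  have hEG : E ≠ G := by
    intro h; rw [h] at hED
    rcases fin2_eq_or_eq_rev aX aE with e' | e'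
    · rw [e', hcfg.arg_G_x] at hED; cases hED
    · rw [e', hcfg.arg_G_y] at hED; cases hED
  have hEB' : E ≠ B := fun h => hnDB ⟨aE, by rw [← h]; exact hED⟩
  have hux : u ≠ x := fun h => case5_D_not_x hS hcfg aD.rev (by rw [hIu, h])
  have huy : u ≠ y := fun h => case5_D_not_y hS hcfg aD.rev (by rw [hIu, h])
  have htu : t ≠ u := by
    intro h; rw [h] at hEt
    have := two_le_fanout hIu hEt hED'.symm
    omega
  have htx : t ≠ x := by
    intro h; rw [h] at hEt
    rcases case5_reader_x hcfg hEt with h' | h'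
    · exact hEG h'
    · exact hEB' h'
  -- the other reader `F` of `D`
  have hED1 : (univ.filter fun a : Fin 2 => C.arg E a = .gate D).card ≤ 1 := by
    rw [card_le_one]
    intro a ha b' hb'
    rw [mem_filter] at ha hb'
    have key : ∀ a', C.arg E a' = .gate D → a' = aE := by
      intro a' h
      rcases fin2_eq_or_eq_rev aE a' with e' | e'
      · exact e'
      · rw [e', hEt] at h; cases h
    rw [key a ha.2, key b' hb'.2]
  obtain ⟨F, aF, hFE, hFD⟩ := exists_reader_ne (by omega) hED1
  have hFD' : F ≠ D := fun h => by rw [h] at hFD; exact C.arg_ne_self_of_not_mem hDK _ hFD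
  have hFG : F ≠ G := by
    intro h; rw [h] at hFD
    rcases fin2_eq_or_eq_rev aX aF with e' | e'
    · rw [e', hcfg.arg_G_x] at hFD; cases hFD
    · rw [e', hcfg.arg_G_y] at hFD; cases hFD
  have hFB : F ≠ B := fun h => hnDB ⟨aF, by rw [← h]; exact hFD⟩
  have hF1 : ∀ a, C.arg F a = .gate D → a = aF := by
    intro a h
    rcases fin2_eq_or_eq_rev aF a with e' | e'
    · exact e'
    · exfalso
      have e2 : ∀ a', C.arg F a' = .gate D := fun a' => by
        rcases fin2_eq_or_eq_rev aF a' with h' | h'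
        · rw [h']; exact hFD
        · rw [h', ← e']; exact h
      exact hN.arg_zero_ne_arg_one F (by rw [e2 0, e2 1])
  -- the hard sub-cases of Case 5.4.1.4.2
  suffices hmain : (∀ u', C.arg F aF.rev = .var u' → ¬ (u' = t ∨ (C.fanout (.gate F) = 1 ∧ C.fanout (.var u') = 2 ∧ ∃ (Y : Fin C.m) (aY : Fin 2) (v : Fin n), IsAndOp (C.op Y) ∧ C.arg Y aY = .gate F ∧ C.arg Y aY.rev = .var v ∧ C.fanout (.gate Y) = 1 ∧ C.fanout (.var v) = 2 ∧ v ≠ u') ∨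
      (C.fanout (.gate F) = 2 ∧ (C.fanout (.var u') = 1 ∨ u' = y)))) → C.StepGoal f R αφ αI αQ by
    cases hW : C.arg F aF.rev with
    | const c => exact hmain fun u' h => by rw [hW] at h; cases h
    | gate g => exact hmain fun u' h => by rw [hW] at h; cases h
    | var u' =>
      by_cases hb : u' = t ∨ (C.fanout (.gate F) = 1 ∧ C.fanout (.var u') = 2 ∧ ∃ (Y : Fin C.m) (aY : Fin 2) (v : Fin n), IsAndOp (C.op Y) ∧ C.arg Y aY = .gate F ∧ C.arg Y aY.rev = .var v ∧ C.fanout (.gate Y) = 1 ∧ C.fanout (.var v) = 2 ∧ v ≠ u') ∨ (C.fanout (.gate F) = 2 ∧ (C.fanout (.var u') = 1 ∨ u' = y))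
      · by_cases hut : u' = t
        · rw [hut] at hW; exact hQ21 t F aF hEt hft hFE hFD hW
        · rcases hb with hb | ⟨h1, h2⟩ | ⟨h1, h2⟩
          · exact absurd hb hut
          · obtain ⟨h2, Y, aY, v, hY1, hY2, hY3, hY4, hY5, hY6⟩ := h2
            exact hQ22 t F aF u' hEt hft hFE hFD hW hut h1 h2 Y aY v hY1 hY2 hY3 hY4 hY5 hY6
          · exact hQ23 t F aF u' hEt hft hFE hFD hW hut h1 h2
      · exact hmain fun u'' h => by rw [hW] at h; cases h; exact hb
  intro hnobad
  -- the reader `H` of `E`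
  obtain ⟨H, aH, hHE⟩ := exists_reader_of_fanout_pos (D := C) (by omega : 0 < C.fanout (.gate E))
  have hHE' : H ≠ E := fun h => by rw [h] at hHE; exact C.arg_ne_self_of_not_mem hEK _ hHE
  have hHG : H ≠ G := by
    intro h; rw [h] at hHE
    rcases fin2_eq_or_eq_rev aX aH with e' | e'
    · rw [e', hcfg.arg_G_x] at hHE; cases hHE
    · rw [e', hcfg.arg_G_y] at hHE; cases hHE
  have hHD : H ≠ D := by
    intro h; rw [h] at hHE
    rcases fin2_eq_or_eq_rev aD aH with e' | e'
    · rw [e', hcfg.arg_D] at hHE; cases hHE; exact hEG rfl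
    · rw [e', hIu] at hHE; cases hHE
  have hHF : H ≠ F := by
    -- else `E` is useless: its reader `F` reads `D`, an input of `E`
    intro h; rw [h] at hHE
    refine hS.normalized.2 E ⟨hE1, F, aH, aE, hFE.symm, hHE, ?_⟩
    rcases fin2_eq_or_eq_rev aH aF with e' | e'
    · rw [e'] at hFD; rw [hFD] at hHE; cases hHE; exact absurd rfl hED'
    · rw [← e', hFD, hED]
  -- the quadratic substitution
  obtain ⟨kE, hkE⟩ := exists_trivializing hEand aE
  obtain ⟨C₃, R', ι, hF₃, hC₃, hdim', hm₃, hιinj, hιD, hιsurj, hconst₃, hvar₃, hgate₃, hop₃, hout₃, hfv₃, hfg₃, hfG₃, hfree',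
    hprot', hq', htroub₃, hμ₃⟩ :=
    quadratic_step (αQ := αQ) hF hC hS hcfg hφ' hI' (E := E) (E' := F) (aE := aE) (aE' := aF) hDn hIu hup hu1 hD2 hEK hED hFD hFE.symm kE
  have hd' : 2 * d + 2 ≤ R'.dim := by omega
  obtain ⟨kG₃, hkG₃⟩ := hιsurj G hcfg.D_ne_G.symm
  obtain ⟨kE₃, hkE₃⟩ := hιsurj E hED'
  obtain ⟨kF₃, hkF₃⟩ := hιsurj F hFD'
  obtain ⟨kH₃, hkH₃⟩ := hιsurj H hHD
  have hE₃c : C₃.arg kE₃ aE = .const kE := hconst₃ kE₃ aE (Or.inl ⟨hkE₃, rfl⟩)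
  have hF₃c : C₃.arg kF₃ aF = .const kE := hconst₃ kF₃ aF (Or.inr ⟨hkF₃, rfl⟩)
  have hnoE : ∀ a, a ≠ aE → ¬ ((ι kE₃ = E ∧ a = aE) ∨ (ι kE₃ = F ∧ a = aF)) := by
    intro a ha h; rcases h with ⟨-, h⟩ | ⟨h, -⟩
    · exact ha h
    · exact hFE (hkE₃.symm.trans h).symm
  have hnoF : ∀ a, a ≠ aF → ¬ ((ι kF₃ = E ∧ a = aE) ∨ (ι kF₃ = F ∧ a = aF)) := by
    intro a ha h; rcases h with ⟨h, -⟩ | ⟨-, h⟩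
    · exact hFE (hkF₃.symm.trans h)
    · exact ha h
  have hnoG : ∀ a, ¬ ((ι kG₃ = E ∧ a = aE) ∨ (ι kG₃ = F ∧ a = aF)) := by
    intro a h; rcases h with ⟨h, -⟩ | ⟨h, -⟩
    · exact hEG (hkG₃.symm.trans h).symm
    · exact hFG (hkG₃.symm.trans h).symm
  have hnoH : ∀ a, ¬ ((ι kH₃ = E ∧ a = aE) ∨ (ι kH₃ = F ∧ a = aF)) := by
    intro a h; rcases h with ⟨h, -⟩ | ⟨h, -⟩
    · exact hHE' (hkH₃.symm.trans h)
    · exact hHF (hkH₃.symm.trans h)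
  have hrevne : ∀ a : Fin 2, a.rev ≠ a := by decide
  have hE₃t : C₃.arg kE₃ aE.rev = .var t := (hvar₃ kE₃ aE.rev (hnoE _ (hrevne aE)) t).mpr (by rw [hkE₃]; exact hEt)
  have hG₃x : C₃.arg kG₃ aX = .var x := (hvar₃ kG₃ aX (hnoG aX) x).mpr (by rw [hkG₃]; exact hcfg.arg_G_x)
  have hG₃y : C₃.arg kG₃ aX.rev = .var y := (hvar₃ kG₃ aX.rev (hnoG _) y).mpr (by rw [hkG₃]; exact hcfg.arg_G_y)
  have hH₃E : C₃.arg kH₃ aH = .gate kE₃ := (hgate₃ kH₃ aH (hnoH aH) kE₃).mpr (by rw [hkH₃, hkE₃]; exact hHE)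
  have hG₃0 : C₃.fanout (.gate kG₃) = 0 := hfG₃ kG₃ hkG₃
  -- step 1: delete the `0`-gate `G`
  have hout₃G : C₃.out ≠ .gate kG₃ := fun h =>
    (out_ne_of_read_bYacyclic hS hDK ⟨aD, hcfg.arg_D⟩) (by rw [(hout₃ kG₃).mp h, hkG₃])
  have hno₄ : ∀ k a, C₃.arg k a ≠ .gate kG₃ := (fanout_eq_zero_iff _ _).mp hG₃0
  let ε₄ := C₃.skipEquiv kG₃
  let C₄ := C₃.removeGate kG₃ ε₄
  have hF₄ : C₄.Fair := hF₃.removeGate ε₄ hno₄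
  have hC₄ : C₄.ComputesRestr f R' := hC₃.removeGate ε₄ hF₃ hno₄ hout₃G
  have hvarG : ∀ a v, C₃.arg kG₃ a = .var v → C₃.fanout (.var v) ≤ 2 := by
    intro a v hv
    rcases fin2_eq_or_eq_rev aX a with e' | e'
    · rw [e', hG₃x] at hv; cases hv; rw [hfv₃ x hux.symm, hcfg.fanout_x]
    · rw [e', hG₃y] at hv; cases hv; rw [hfv₃ y huy.symm, hcfg.fanout_y]
  have hgateG : ∀ a g, C₃.arg kG₃ a = .gate g → C₃.fanout (.gate g) ≤ 1 := by
    intro a g hg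
    rcases fin2_eq_or_eq_rev aX a with e' | e'
    · rw [e', hG₃x] at hg; cases hg
    · rw [e', hG₃y] at hg; cases hg
  obtain ⟨P₄, hP₄, hpot₄⟩ := exists_packing_removeGate_noNew C₃ kG₃ ε₄ hno₄ C₃.isPacking_empty hvarG hgateG
  -- images in `C₄`
  have hkEG : kE₃ ≠ kG₃ := fun h => hEG (by rw [← hkE₃, ← hkG₃, h])
  have hkFG : kF₃ ≠ kG₃ := fun h => hFG (by rw [← hkF₃, ← hkG₃, h])
  have hkHG : kH₃ ≠ kG₃ := fun h => hHG (by rw [← hkH₃, ← hkG₃, h])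
  have hkEF : kE₃ ≠ kF₃ := fun h => hFE (by rw [← hkE₃, ← hkF₃, h])
  have hkHE : kH₃ ≠ kE₃ := fun h => hHE' (by rw [← hkH₃, ← hkE₃, h])
  have hkHF : kH₃ ≠ kF₃ := fun h => hHF (by rw [← hkH₃, ← hkF₃, h])
  let kE₄ : Fin C₄.m := ε₄.symm ⟨kE₃, hkEG⟩
  let kF₄ : Fin C₄.m := ε₄.symm ⟨kF₃, hkFG⟩
  let kH₄ : Fin C₄.m := ε₄.symm ⟨kH₃, hkHG⟩
  have hεE : (ε₄ kE₄ : Fin C₃.m) = kE₃ := by show ((ε₄ (ε₄.symm ⟨kE₃, hkEG⟩)) : Fin C₃.m) = kE₃; rw [Equiv.apply_symm_apply ε₄]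
  have hεF : (ε₄ kF₄ : Fin C₃.m) = kF₃ := by show ((ε₄ (ε₄.symm ⟨kF₃, hkFG⟩)) : Fin C₃.m) = kF₃; rw [Equiv.apply_symm_apply ε₄]
  have hεH : (ε₄ kH₄ : Fin C₃.m) = kH₃ := by show ((ε₄ (ε₄.symm ⟨kH₃, hkHG⟩)) : Fin C₃.m) = kH₃; rw [Equiv.apply_symm_apply ε₄]
  have hE₄c : C₄.arg kE₄ aE = .const kE := by show (C₃.arg (ε₄ kE₄) aE).skip kG₃ ε₄ = _; rw [hεE, hE₃c]; rfl
  have hE₄t : C₄.arg kE₄ aE.rev = .var t := by show (C₃.arg (ε₄ kE₄) aE.rev).skip kG₃ ε₄ = _; rw [hεE, hE₃t]; rfl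
  have hF₄c : C₄.arg kF₄ aF = .const kE := by show (C₃.arg (ε₄ kF₄) aF).skip kG₃ ε₄ = _; rw [hεF, hF₃c]; rfl
  have hH₄E : C₄.arg kH₄ aH = .gate kE₄ := by
    show (C₃.arg (ε₄ kH₄) aH).skip kG₃ ε₄ = _; rw [hεH, hH₃E]; exact Node.skip_gate_of_ne kG₃ ε₄ hkEG
  have hopE₄ : C₄.op kE₄ = C.op E := by show C₃.op (ε₄ kE₄) = _; rw [hεE, hop₃, hkE₃]
  have hfv₄ : ∀ v, C₄.fanout (.var v) ≤ C₃.fanout (.var v) := by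
    intro v
    have h1 := C₃.fanout_removeGate_add kG₃ ε₄ hno₄ (v := .var v) (fun h => by cases h)
    change C₄.fanout (.var v) + _ = _ at h1
    omega
  have hfg₄ : ∀ k : Fin C₄.m, C₄.fanout (.gate k) = C₃.fanout (.gate (ε₄ k : Fin C₃.m)) := by
    intro k
    have h1 := C₃.fanout_removeGate_add kG₃ ε₄ hno₄ (v := .gate (ε₄ k : Fin C₃.m)) (fun h => (ε₄ k).2 (Node.gate.inj h))
    have h2 : (univ.filter fun a : Fin 2 => C₃.arg kG₃ a = .gate (ε₄ k : Fin C₃.m)).card = 0 := by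
      rw [card_eq_zero, filter_eq_empty_iff]
      intro a _ h
      rcases fin2_eq_or_eq_rev aX a with e' | e'
      · rw [e', hG₃x] at h; cases h
      · rw [e', hG₃y] at h; cases h
    have hskip : (Node.gate (ε₄ k : Fin C₃.m) : Node n C₃.m).skip kG₃ ε₄ = .gate k := Node.skip_gate_coe kG₃ ε₄ k
    rw [hskip, h2] at h1
    change C₄.fanout (.gate k) + 0 = _ at h1
    omega
  -- step 2: `E` is trivialized by the constant `kE`
  have htriv₄ : C₄.liveFn kE₄ aE kE false = C₄.liveFn kE₄ aE kE true := by
    unfold liveFn at hkE ⊢; rw [hopE₄]; exact hkE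
  have hout₄E : C₄.out ≠ .gate kE₄ := out_ne_of_trivialized hf (by omega) hF₄ hC₄ hE₄c htriv₄
  let E₅ := elimDataWTriv hF₄ hC₄ hP₄ hE₄c htriv₄ hout₄E hφ' hI' αQ
  have hr₅ : E₅.repl = .const (C₄.liveFn kE₄ aE kE false) := rfl
  -- no new troubled gate: the only non-constant input of `E` is `t`, a `1`-variable afterwards
  have hft₅ : E₅.C'.fanout (.var t) ≤ 1 := by
    have h1 := E₅.fanout_var_add (i := t) (by rw [hr₅]; exact fun h => by cases h)
    have h2 : 1 ≤ (univ.filter fun a : Fin 2 => C₄.arg kE₄ a = .var t).card :=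
      card_pos.mpr ⟨aE.rev, mem_filter.mpr ⟨mem_univ _, hE₄t⟩⟩
    have h3 := hfv₄ t
    rw [hfv₃ t htu, hft] at h3
    omega
  have hnonew₅ : ∀ k', E₅.C'.Troubled k' → ¬ C₄.Troubled (E₅.ι k') → False := by
    intro k' hT' hT
    obtain ⟨a, ha⟩ := E₅.causedBy_of_new_troubled k' hT' hT
    rcases fin2_eq_or_eq_rev aE a with e' | e'
    · rw [e', hE₄c] at ha; exact not_causedBy_const ha
    · rw [e', hE₄t] at ha
      rcases ha with ha | ⟨z', hz', a', ha'⟩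
      · cases ha
      · cases hz'
        have := hT'.fanout_eq_two ha'
        omega
  obtain ⟨P₅, hP₅, hpot₅⟩ := E₅.exists_packing_of_cover hP₄ ∅ ∅ (fun k' hT' hT => (hnonew₅ k' hT' hT).elim)
    (Or.inl (by simp)) (Or.inl (by simp))
  simp only [if_true, Nat.cast_zero, add_zero] at hpot₅
  -- images in `E₅.C'`
  obtain ⟨kF₅, hkF₅⟩ := E₅.ι_surj kF₄ (fun h => hkEF (by
    have : (ε₄ kF₄ : Fin C₃.m) = (ε₄ kE₄ : Fin C₃.m) := by rw [h]
    rw [hεF, hεE] at this; exact this.symm))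
  obtain ⟨kH₅, hkH₅⟩ := E₅.ι_surj kH₄ (fun h => hkHE (by
    have : (ε₄ kH₄ : Fin C₃.m) = (ε₄ kE₄ : Fin C₃.m) := by rw [h]
    rw [hεH, hεE] at this; exact this))
  have hF₅c : E₅.C'.arg kF₅ aF = .const kE := (E₅.arg_eq_const_iff kF₅ aF kE).mpr (Or.inl (by rw [hkF₅]; exact hF₄c))
  have hH₅c : E₅.C'.arg kH₅ aH = .const (C₄.liveFn kE₄ aE kE false) :=
    (E₅.arg_eq_const_iff kH₅ aH _).mpr (Or.inr ⟨by rw [hkH₅]; exact hH₄E, hr₅⟩)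
  have hkHF₅ : kH₅ ≠ kF₅ := by
    intro h
    have := congrArg E₅.ι h; rw [hkH₅, hkF₅] at this
    have h2 : (ε₄ kH₄ : Fin C₃.m) = (ε₄ kF₄ : Fin C₃.m) := by rw [this]
    rw [hεH, hεF] at h2; exact hkHF h2
  -- step 3: the other reader `F` of `D`, fed by the constant `kE`
  let E₆ := elimDataWConstFed hf hd' E₅.fair E₅.computes hP₅ hF₅c hφ' hI' αQ
  have hr₆ : (∃ b, E₆.repl = .const b) ∨ E₆.repl = E₅.C'.arg kF₅ aF.rev := by
    rcases E₆.repl_cases with h | ⟨a, ha⟩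
    · exact Or.inl h
    · rcases fin2_eq_or_eq_rev aF a with e' | e'
      · rw [e', hF₅c] at ha; exact Or.inl ⟨_, ha.symm⟩
      · rw [e'] at ha; exact Or.inr ha.symm
  -- `F` does not read `E` (whose only reader is `H`), `E` does not read `F`
  have hFnE : ∀ a, C.arg F a ≠ .gate E := fun a h => by have := two_le_fanout hHE h hHF; omega
  have hEnF : ∀ a, C₄.arg kE₄ a ≠ .gate kF₄ := by
    intro a h
    rcases fin2_eq_or_eq_rev aE a with e' | e'
    · rw [e', hE₄c] at h; cases h
    · rw [e', hE₄t] at h; cases h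
  have hwF : ∀ a, C₄.arg kF₄ a = (C₃.arg kF₃ a).skip kG₃ ε₄ := fun a => by show (C₃.arg (ε₄ kF₄) a).skip kG₃ ε₄ = _; rw [hεF]
  -- generic transports from `E₅.C'` down to `C`
  -- (a) variables only lose wires: `fanout₅ v ≤ fanout₄ v ≤ fanout₃ v = fanout v` (`v ≠ u`), `fanout₃ u = 0`
  have hfv₅ : ∀ v, E₅.C'.fanout (.var v) ≤ C₄.fanout (.var v) := by
    intro v
    have h1 := E₅.fanout_var_add (i := v) (by rw [hr₅]; exact fun h => by cases h)
    omega
  have hfvC : ∀ v, E₅.C'.fanout (.var v) ≤ C.fanout (.var v) ∧ (v = u → E₅.C'.fanout (.var v) = 0) := by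
    intro v
    have h1 := hfv₅ v; have h2 := hfv₄ v
    by_cases hvu : v = u
    · rw [hvu] at h1 h2 ⊢
      have h3 : C₃.fanout (.var u) = 0 := by
        have := hC₃.1 u (fun h => ((hfree' u).mp h).2 rfl); exact this
      exact ⟨by omega, fun _ => by omega⟩
    · rw [hfv₃ v hvu] at h2; exact ⟨by omega, fun h => absurd h hvu⟩
  -- (b) a gate `g₅` of `E₅.C'` not read by... : its out-degree equals that of its image in `C`
  have hfg₅ : ∀ g₅ : Fin E₅.C'.m, E₅.C'.fanout (.gate g₅) = C.fanout (.gate (ι (ε₄ (E₅.ι g₅) : Fin C₃.m))) := by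
    intro g₅
    have h1 : E₅.C'.fanout (.gate g₅) = C₄.fanout (.gate (E₅.ι g₅)) := by
      apply E₅.fanout_gate_eq
      · intro a h
        rcases fin2_eq_or_eq_rev aE a with e' | e'
        · rw [e', hE₄c] at h; cases h
        · rw [e', hE₄t] at h; cases h
      · rw [hr₅]; exact fun h => by cases h
    rw [h1, hfg₄]
    apply hfg₃
    intro h
    have : (ε₄ (E₅.ι g₅) : Fin C₃.m) = kG₃ := hιinj (h.trans hkG₃.symm)
    exact (ε₄ (E₅.ι g₅)).2 this
  -- (c) a variable wire of a gate of `E₅.C'` is the same wire in `C`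
  have hvw₅ : ∀ (g₅ : Fin E₅.C'.m) (a : Fin 2) (v : Fin n), E₅.C'.arg g₅ a = .var v →
      C.arg (ι (ε₄ (E₅.ι g₅) : Fin C₃.m)) a = .var v := by
    intro g₅ a v h
    rw [E₅.arg_eq_var_iff] at h
    rcases h with h | ⟨-, h⟩
    swap; · rw [hr₅] at h; cases h
    change (C₃.arg (ε₄ (E₅.ι g₅)) a).skip kG₃ ε₄ = .var v at h
    rw [Node.skip_eq_var_iff] at h
    have hno : ¬ ((ι (ε₄ (E₅.ι g₅) : Fin C₃.m) = E ∧ a = aE) ∨ (ι (ε₄ (E₅.ι g₅) : Fin C₃.m) = F ∧ a = aF)) := by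
      rintro (⟨h1, h2⟩ | ⟨h1, h2⟩)
      · have : (ε₄ (E₅.ι g₅) : Fin C₃.m) = kE₃ := hιinj (h1.trans hkE₃.symm)
        rw [this, h2, hE₃c] at h; cases h
      · have : (ε₄ (E₅.ι g₅) : Fin C₃.m) = kF₃ := hιinj (h1.trans hkF₃.symm)
        rw [this, h2, hF₃c] at h; cases h
    exact (hvar₃ _ a hno v).mp h
  -- (d) ∧-type is preserved
  have hand₅ : ∀ g₅ : Fin E₅.C'.m, IsAndOp (E₅.C'.op g₅) → IsAndOp (C.op (ι (ε₄ (E₅.ι g₅) : Fin C₃.m))) := by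
    intro g₅ h
    rw [E₅.isAndOp_iff] at h
    change IsAndOp (C₃.op (ε₄ (E₅.ι g₅))) at h
    rw [hop₃] at h; exact h
  -- contradiction X: an ∧-type gate of `E₅.C'` of out-degree `2` with a `2⁺`-variable wire
  have hX : ∀ (g₅ : Fin E₅.C'.m) (a : Fin 2) (v : Fin n), IsAndOp (E₅.C'.op g₅) → E₅.C'.arg g₅ a = .var v →
      2 ≤ E₅.C'.fanout (.var v) → E₅.C'.fanout (.gate g₅) = 2 → False := by
    intro g₅ a v hand hv hv2 hg2
    have h1 := hS.and_fanout_le v _ a (hvw₅ g₅ a v hv) (hand₅ g₅ hand)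
    rw [← hfg₅ g₅, hg2] at h1
    have h2 := (hfvC v).1
    omega
  -- `F`'s other wire in `C`, if a variable
  have hWvar : ∀ z, E₅.C'.arg kF₅ aF.rev = .var z → C.arg F aF.rev = .var z := by
    intro z h; have := hvw₅ kF₅ aF.rev z h; rw [hkF₅, hεF, hkF₃] at this; exact this
  have hnonew₆ : ∀ k'', E₆.C'.Troubled k'' → ¬ E₅.C'.Troubled (E₆.ι k'') → False := by
    intro k'' hT' hT
    obtain ⟨a, ha⟩ := E₆.causedBy_of_new_troubled k'' hT' hT
    rcases fin2_eq_or_eq_rev aF a with e' | e'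
    · rw [e', hF₅c] at ha; exact not_causedBy_const ha
    rw [e'] at ha
    cases hW₅ : E₅.C'.arg kF₅ aF.rev with
    | const c => rw [hW₅] at ha; exact not_causedBy_const ha
    | gate g₅ =>
      rw [hW₅] at ha
      rcases ha with ha | ⟨z', hz', -⟩
      swap; · cases hz'
      have hg : g₅ = E₆.ι k'' := Node.gate.inj ha
      -- `repl ∈ {const, gate g₅}`
      have hrepl : (∃ b, E₆.repl = .const b) ∨ E₆.repl = .gate g₅ := by
        rcases hr₆ with h | h
        · exact Or.inl h
        · rw [hW₅] at h; exact Or.inr h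
      have hcnt : (univ.filter fun a' : Fin 2 => E₅.C'.arg kF₅ a' = .gate g₅).card = 1 := by
        rw [card_eq_one]; refine ⟨aF.rev, ?_⟩
        ext a'; rw [mem_filter, mem_singleton]
        constructor
        · intro ⟨_, h⟩
          rcases fin2_eq_or_eq_rev aF a' with e'' | e''
          · rw [e'', hF₅c] at h; cases h
          · exact e''
        · intro h; rw [h]; exact ⟨mem_univ _, hW₅⟩
      -- wires of `k''` are those of `g₅`
      have hwires : ∀ a' v, E₆.C'.arg k'' a' = .var v → E₅.C'.arg g₅ a' = .var v := by
        intro a' v h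
        rw [E₆.arg_eq_var_iff, ← hg] at h
        rcases h with h | ⟨-, h⟩
        · exact h
        · rcases hrepl with ⟨b, hb⟩ | hb
          · rw [hb] at h; cases h
          · rw [hb] at h; cases h
      obtain ⟨v₁, hv₁⟩ := hT'.arg_isVar 0
      have hv₁2 : E₆.C'.fanout (.var v₁) = 2 := hT'.fanout_eq_two hv₁
      have hv₁5 : 2 ≤ E₅.C'.fanout (.var v₁) := by
        have h1 := E₆.fanout_var_add (i := v₁) (by
          rcases hrepl with ⟨b, hb⟩ | hb
          · rw [hb]; exact fun h => by cases h
          · rw [hb]; exact fun h => by cases h)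
        omega
      have handg : IsAndOp (E₅.C'.op g₅) := by rw [hg]; exact (E₆.isAndOp_iff k'').mp hT'.1
      rcases hrepl with ⟨b, hb⟩ | hb
      · -- trivialized: `fanout₅ g₅ = 2`
        have h1 := E₆.fanout_gate_add (k' := k'') (by rw [hb]; exact fun h => by cases h)
        rw [← hg, hcnt, hT'.2.1] at h1
        exact hX g₅ 0 v₁ handg (hwires 0 v₁ hv₁) hv₁5 h1.symm
      · -- degenerate, passing `g₅`: `fanout₅ g₅ + fanout₅ F = 2`
        have h1 := E₆.fanout_repl_add
        rw [hb, hcnt] at h1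
        have hpull : E₆.pull (.gate g₅) = .gate k'' := by rw [hg]; exact E₆.pull_ι k''
        rw [hpull, hT'.2.1] at h1
        have hF5 : 1 ≤ E₅.C'.fanout (.gate kF₅) := by
          -- `F` reads the live gate wire... it is not the output? use: `g₅` has out-degree ≤ 1 here; if
          -- `fanout₅ F = 0` then `fanout₅ g₅ = 2`: contradiction X
          by_contra h0
          have : E₅.C'.fanout (.gate g₅) = 2 := by omega
          exact hX g₅ 0 v₁ handg (hwires 0 v₁ hv₁) hv₁5 this
        have hg5 : 1 ≤ E₅.C'.fanout (.gate g₅) := one_le_fanout_of_arg_eq hW₅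
        have hg51 : E₅.C'.fanout (.gate g₅) = 1 := by omega
        -- then `g₅` was troubled already
        apply hT
        rw [← hg]
        obtain ⟨hand', -, w₁, w₂, hne, hrange, hw₁, hw₂⟩ := hT'
        have hfw : ∀ w, E₆.C'.fanout (.var w) = E₅.C'.fanout (.var w) := by
          intro w
          have h2 := E₆.fanout_var_add (i := w) (by rw [hb]; exact fun h => by cases h)
          have h3 : (univ.filter fun a' : Fin 2 => E₅.C'.arg kF₅ a' = .var w).card = 0 := by
            rw [card_eq_zero, filter_eq_empty_iff]
            intro a' _ h
            rcases fin2_eq_or_eq_rev aF a' with e'' | e''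
            · rw [e'', hF₅c] at h; cases h
            · rw [e'', hW₅] at h; cases h
          rw [h3] at h2; omega
        refine ⟨handg, hg51, w₁, w₂, hne, ?_, by rw [← hfw]; exact hw₁, by rw [← hfw]; exact hw₂⟩
        ext nd
        constructor
        · rintro ⟨a', rfl⟩
          have hm : E₆.C'.arg k'' a' ∈ Set.range (E₆.C'.arg k'') := ⟨a', rfl⟩
          rw [hrange] at hm
          rcases hm with hm | hm
          · rw [hwires a' w₁ hm]; exact Or.inl rfl
          · rw [hwires a' w₂ hm]; exact Or.inr rfl
        · intro hm
          rcases hm with hm | hm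
          · obtain ⟨a', ha'⟩ : (Node.var w₁ : Node n E₆.C'.m) ∈ Set.range (E₆.C'.arg k'') := by rw [hrange]; exact Or.inl rfl
            exact ⟨a', by rw [hm]; exact hwires a' w₁ ha'⟩
          · obtain ⟨a', ha'⟩ : (Node.var w₂ : Node n E₆.C'.m) ∈ Set.range (E₆.C'.arg k'') := by rw [hrange]; exact Or.inr rfl
            exact ⟨a', by rw [hm]; exact hwires a' w₂ ha'⟩
    | var z =>
      rw [hW₅] at ha
      rcases ha with ha | ⟨z', hz', a', ha'⟩
      · cases ha
      cases hz'
      have hz2 : E₆.C'.fanout (.var z) = 2 := hT'.fanout_eq_two ha'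
      have hcnt : (univ.filter fun a'' : Fin 2 => E₅.C'.arg kF₅ a'' = .var z).card = 1 := by
        rw [card_eq_one]; refine ⟨aF.rev, ?_⟩
        ext a''; rw [mem_filter, mem_singleton]
        constructor
        · intro ⟨_, h⟩
          rcases fin2_eq_or_eq_rev aF a'' with e'' | e''
          · rw [e'', hF₅c] at h; cases h
          · exact e''
        · intro h; rw [h]; exact ⟨mem_univ _, hW₅⟩
      have hrepl : (∃ b, E₆.repl = .const b) ∨ E₆.repl = .var z := by
        rcases hr₆ with h | h
        · exact Or.inl h
        · rw [hW₅] at h; exact Or.inr h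
      have handA : IsAndOp (E₅.C'.op (E₆.ι k'')) := (E₆.isAndOp_iff k'').mp hT'.1
      rcases hrepl with ⟨b, hb⟩ | hb
      · -- trivialized: `fanout₅ z = 3`, and `k''` reads `z` already in `E₅.C'`
        have h1 := E₆.fanout_var_add (i := z) (by rw [hb]; exact fun h => by cases h)
        rw [hcnt, hz2] at h1
        have hAz : E₅.C'.arg (E₆.ι k'') a' = .var z := by
          rw [E₆.arg_eq_var_iff] at ha'
          rcases ha' with h | ⟨-, h⟩
          · exact h
          · rw [hb] at h; cases h
        have h2 := hS.and_fanout_le z _ a' (hvw₅ _ a' z hAz) (hand₅ _ handA)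
        have h3 := (hfvC z).1
        have h4 : 1 ≤ C.fanout (.gate (ι (ε₄ (E₅.ι (E₆.ι k'')) : Fin C₃.m))) := by
          rw [← hfg₅]
          have h5 := E₆.fanout_gate_add (k' := k'') (by rw [hb]; exact fun h => by cases h)
          rw [hT'.2.1] at h5; omega
        omega
      · -- degenerate, passing `z`: `fanout₅ z + fanout₅ F = 3`, one of the hard sub-cases
        have h1 := E₆.fanout_repl_add
        rw [hb, hcnt] at h1
        change E₆.C'.fanout (.var z) + 1 = _ at h1
        rw [hz2] at h1
        have hWz : C.arg F aF.rev = .var z := hWvar z hW₅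
        -- `fanout₅ F = fanout F ≥ 1`
        have hFout : E₅.C'.out ≠ .gate kF₅ := out_ne_of_live_var hf hd' E₅.fair E₅.computes hF₅c hW₅
        have hfF : E₅.C'.fanout (.gate kF₅) = C.fanout (.gate F) := by rw [hfg₅ kF₅, hkF₅, hεF, hkF₃]
        have hF1 : 1 ≤ C.fanout (.gate F) := by
          by_contra h0; push Not at h0
          have hCout : C.out = .gate F := hN.out_of_fanout_eq_zero F (by omega)
          apply hFout
          -- transport the output
          have ho₃ : C₃.out = .gate kF₃ := (hout₃ kF₃).mpr (by rw [hkF₃]; exact hCout)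
          have ho₄ : C₄.out = .gate kF₄ := by
            show C₃.out.skip kG₃ ε₄ = .gate kF₄; rw [ho₃, Node.skip_eq_gate_iff, hεF]
          have e5 := E₅.out_eq; rw [if_neg hout₄E, ho₄] at e5
          apply E₅.embed_injective
          show E₅.C'.out.embed E₅.ι = (Node.gate kF₅ : Node n _).embed E₅.ι
          rw [e5]; show Node.gate kF₄ = Node.gate (E₅.ι kF₅); rw [hkF₅]
        -- `fanout₅ z = fanout z - [z = y] - [z = t]`
        have hzu : z ≠ u := by
          intro h; rw [h] at hWz; have := two_le_fanout hIu hWz hFD'.symm; omega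
        have hzx : z ≠ x := by
          intro h; rw [h] at hWz
          rcases case5_reader_x hcfg hWz with h' | h'
          · exact hFG h'
          · exact hFB h'
        have h34 : C₄.fanout (.var z) + (if z = y then 1 else 0) = C.fanout (.var z) := by
          have h2 := C₃.fanout_removeGate_add kG₃ ε₄ hno₄ (v := .var z) (fun h => by cases h)
          change C₄.fanout (.var z) + _ = _ at h2
          rw [hfv₃ z hzu] at h2
          have h3 : (univ.filter fun a'' : Fin 2 => C₃.arg kG₃ a'' = .var z).card = if z = y then 1 else 0 := by
            split_ifs with hzy
            · rw [card_eq_one]; refine ⟨aX.rev, ?_⟩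
              ext a''; rw [mem_filter, mem_singleton]
              constructor
              · intro ⟨_, h⟩
                rcases fin2_eq_or_eq_rev aX a'' with e'' | e''
                · rw [e'', hG₃x] at h; cases h; exact absurd rfl hzx
                · exact e''
              · intro h; rw [h, hzy]; exact ⟨mem_univ _, hG₃y⟩
            · rw [card_eq_zero, filter_eq_empty_iff]
              intro a'' _ h
              rcases fin2_eq_or_eq_rev aX a'' with e'' | e''
              · rw [e'', hG₃x] at h; cases h; exact hzx rfl
              · rw [e'', hG₃y] at h; cases h; exact hzy rfl
          rw [h3] at h2; exact h2
        have h45 : E₅.C'.fanout (.var z) + (if z = t then 1 else 0) = C₄.fanout (.var z) := by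
          have h2 := E₅.fanout_var_add (i := z) (by rw [hr₅]; exact fun h => by cases h)
          have h3 : (univ.filter fun a'' : Fin 2 => C₄.arg kE₄ a'' = .var z).card = if z = t then 1 else 0 := by
            split_ifs with hzt
            · rw [card_eq_one]; refine ⟨aE.rev, ?_⟩
              ext a''; rw [mem_filter, mem_singleton]
              constructor
              · intro ⟨_, h⟩
                rcases fin2_eq_or_eq_rev aE a'' with e'' | e''
                · rw [e'', hE₄c] at h; cases h
                · exact e''
              · intro h; rw [h, hzt]; exact ⟨mem_univ _, hE₄t⟩
            · rw [card_eq_zero, filter_eq_empty_iff]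
              intro a'' _ h
              rcases fin2_eq_or_eq_rev aE a'' with e'' | e''
              · rw [e'', hE₄c] at h; cases h
              · rw [e'', hE₄t] at h; cases h; exact hzt rfl
          rw [h3] at h2; exact h2
        have hz1 : 1 ≤ C.fanout (.var z) := one_le_fanout_of_arg_eq hWz
        -- the new troubled gate `A` read `F` (else it was troubled before), its data for Case 5.4.1.4.2.2
        have hYdata : C.fanout (.gate F) = 1 → ∃ (Y : Fin C.m) (aY : Fin 2) (v : Fin n), IsAndOp (C.op Y) ∧ C.arg Y aY = .gate F ∧ C.arg Y aY.rev = .var v ∧ C.fanout (.gate Y) = 1 ∧ C.fanout (.var v) = 2 ∧ v ≠ z := by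
          intro hF1'
          have hz5 : E₅.C'.fanout (.var z) = 2 := by rw [hfF, hF1'] at h1; omega
          obtain ⟨-, hf1, w₁, w₂, hne, hrange, hw₁, hw₂⟩ := id hT'
          -- the other wire of `k''`
          have hother : ∃ v, E₆.C'.arg k'' a'.rev = .var v ∧ v ≠ z ∧ E₆.C'.fanout (.var v) = 2 := by
            have hm : E₆.C'.arg k'' a'.rev ∈ Set.range (E₆.C'.arg k'') := ⟨a'.rev, rfl⟩
            rw [hrange] at hm
            have hza : E₆.C'.arg k'' a' ∈ Set.range (E₆.C'.arg k'') := ⟨a', rfl⟩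
            rw [hrange, ha'] at hza
            have hboth : ∀ v, E₆.C'.arg k'' a'.rev = .var v → v = z → False := by
              intro v hv hvz
              rw [hvz] at hv
              -- both wires are `z`: the range is a singleton
              have hsub : Set.range (E₆.C'.arg k'') ⊆ {Node.var z} := by
                rintro nd ⟨a'', rfl⟩
                rcases fin2_eq_or_eq_rev a' a'' with e'' | e''
                · rw [e'', ha']; rfl
                · rw [e'', hv]; rfl
              rw [hrange] at hsub
              have h1' : (Node.var w₁ : Node n E₆.C'.m) = .var z := hsub (Or.inl rfl)
              have h2' : (Node.var w₂ : Node n E₆.C'.m) = .var z := hsub (Or.inr rfl)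
              exact hne (by cases h1'; cases h2'; rfl)
            rcases hm with hm | hm
            · refine ⟨w₁, hm, fun h => hboth w₁ hm h, hw₁⟩
            · refine ⟨w₂, hm, fun h => hboth w₂ hm h, hw₂⟩
          obtain ⟨v, hv, hvz, hv2⟩ := hother
          have hv5 : E₅.C'.arg (E₆.ι k'') a'.rev = .var v := by
            rw [E₆.arg_eq_var_iff] at hv
            rcases hv with h | ⟨-, h⟩
            · exact h
            · rw [hb] at h; cases h; exact absurd rfl hvz
          have hfv5 : E₅.C'.fanout (.var v) = 2 := by
            have h2 := E₆.fanout_var_add (i := v) (by rw [hb]; exact fun h => hvz (Node.var.inj h).symm)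
            have h3 : (univ.filter fun a'' : Fin 2 => E₅.C'.arg kF₅ a'' = .var v).card = 0 := by
              rw [card_eq_zero, filter_eq_empty_iff]
              intro a'' _ h
              rcases fin2_eq_or_eq_rev aF a'' with e'' | e''
              · rw [e'', hF₅c] at h; cases h
              · rw [e'', hW₅] at h; cases h; exact hvz rfl
            rw [h3] at h2; omega
          have hfA5 : E₅.C'.fanout (.gate (E₆.ι k'')) = 1 := by
            have h2 := E₆.fanout_gate_add (k' := k'') (by rw [hb]; exact fun h => by cases h)
            have h3 : (univ.filter fun a'' : Fin 2 => E₅.C'.arg kF₅ a'' = .gate (E₆.ι k'')).card = 0 := by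
              rw [card_eq_zero, filter_eq_empty_iff]
              intro a'' _ h
              rcases fin2_eq_or_eq_rev aF a'' with e'' | e''
              · rw [e'', hF₅c] at h; cases h
              · rw [e'', hW₅] at h; cases h
            rw [h3, hf1] at h2; omega
          -- `k''` reads `F` in `E₅.C'` (else it was troubled there)
          have hAF : E₅.C'.arg (E₆.ι k'') a' = .gate kF₅ := by
            rw [E₆.arg_eq_var_iff] at ha'
            rcases ha' with h | ⟨h, -⟩
            · exfalso; apply hT
              refine ⟨handA, hfA5, z, v, hvz.symm, ?_, hz5, hfv5⟩
              ext nd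
              constructor
              · rintro ⟨a'', rfl⟩
                rcases fin2_eq_or_eq_rev a' a'' with e'' | e''
                · rw [e'', h]; exact Or.inl rfl
                · rw [e'', hv5]; exact Or.inr rfl
              · intro hm
                rcases hm with hm | hm
                · exact ⟨a', by rw [hm]; exact h⟩
                · exact ⟨a'.rev, by rw [hm]; exact hv5⟩
            · exact h
          -- transport to `C`
          let Y : Fin C.m := ι (ε₄ (E₅.ι (E₆.ι k'')) : Fin C₃.m)
          have hYF : C.arg Y a' = .gate F := by
            have h4 : C₄.arg (E₅.ι (E₆.ι k'')) a' = .gate kF₄ := by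
              have := hAF; rw [E₅.arg_eq_gate_iff, hkF₅] at this
              rcases this with h | ⟨-, h⟩
              · exact h
              · rw [hr₅] at h; cases h
            change (C₃.arg (ε₄ (E₅.ι (E₆.ι k''))) a').skip kG₃ ε₄ = .gate kF₄ at h4
            rw [Node.skip_eq_gate_iff, hεF] at h4
            have hno' : ¬ ((ι (ε₄ (E₅.ι (E₆.ι k'')) : Fin C₃.m) = E ∧ a' = aE) ∨ (ι (ε₄ (E₅.ι (E₆.ι k'')) : Fin C₃.m) = F ∧ a' = aF)) := by
              rintro (⟨h1', -⟩ | ⟨h1', -⟩)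
              · have : (ε₄ (E₅.ι (E₆.ι k'')) : Fin C₃.m) = kE₃ := hιinj (h1'.trans hkE₃.symm)
                have h5 : E₅.ι (E₆.ι k'') = kE₄ := ε₄.injective (Subtype.ext (this.trans hεE.symm))
                exact E₅.ι_ne _ h5
              · have : (ε₄ (E₅.ι (E₆.ι k'')) : Fin C₃.m) = kF₃ := hιinj (h1'.trans hkF₃.symm)
                have h5 : E₅.ι (E₆.ι k'') = kF₄ := ε₄.injective (Subtype.ext (this.trans hεF.symm))
                exact E₆.ι_ne k'' (E₅.ι_injective (h5.trans hkF₅.symm))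
            have := (hgate₃ _ a' hno' kF₃).mp h4
            rw [hkF₃] at this; exact this
          have hYv : C.arg Y a'.rev = .var v := hvw₅ _ a'.rev v hv5
          have hYand : IsAndOp (C.op Y) := hand₅ _ handA
          have hY1 : C.fanout (.gate Y) = 1 := by rw [← hfg₅]; exact hfA5
          have hv2C : C.fanout (.var v) = 2 := by
            have h2 := (hfvC v).1
            have h3 := hS.and_fanout_le v Y a'.rev hYv hYand
            omega
          exact ⟨Y, a', v, hYand, hYF, hYv, hY1, hv2C, hvz⟩
        refine hnobad z hWz ?_
        by_cases hzt : z = t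
        · exact Or.inl hzt
        · rw [if_neg hzt] at h45
          by_cases hzy : z = y
          · rw [if_pos hzy] at h34
            have hy2 := hcfg.fanout_y
            rw [← hzy] at hy2
            right; right
            refine ⟨by omega, Or.inr hzy⟩
          · rw [if_neg hzy] at h34
            right
            rcases Nat.lt_or_ge (C.fanout (.gate F)) 2 with hlt | hge
            · left; exact ⟨by omega, by omega, hYdata (by omega)⟩
            · right; exact ⟨by omega, Or.inl (by omega)⟩
  obtain ⟨P₆, hP₆, hpot₆⟩ := E₆.exists_packing_of_cover hP₅ ∅ ∅ (fun k' hT' hT => (hnonew₆ k' hT' hT).elim)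
    (Or.inl (by simp)) (Or.inl (by simp))
  simp only [if_true, Nat.cast_zero, add_zero] at hpot₆
  -- step 4: the reader `H` of `E`, fed by a constant
  obtain ⟨kH₆, hkH₆⟩ := E₆.ι_surj kH₅ hkHF₅
  have hH₆c : E₆.C'.arg kH₆ aH = .const (C₄.liveFn kE₄ aE kE false) :=
    (E₆.arg_eq_const_iff kH₆ aH _).mpr (Or.inl (by rw [hkH₆]; exact hH₅c))
  let E₇ := elimDataWConstFed hf hd' E₆.fair E₆.computes hP₆ hH₆c hφ' hI' αQ
  -- accounting
  have hm₄ : (C₄.m : ℝ) + 1 = C₃.m := by exact_mod_cast C₃.removeGate_m_add_one kG₃ ε₄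
  have hinf₄ : ((C₄.influential R').card : ℝ) ≤ (C₃.influential R').card := by
    exact_mod_cast card_le_card (C₃.influential_removeGate_subset kG₃ ε₄ hno₄ R')
  have hpot₄' : (C₄.potential P₄ : ℝ) ≤ C₃.potential ∅ := by exact_mod_cast hpot₄
  have hμ₄ : C₄.measure αφ αI αQ P₄ R' ≤ C₃.measure αφ αI αQ ∅ R' - 1 := by
    unfold measure
    nlinarith [mul_le_mul_of_nonneg_left hinf₄ hI', mul_le_mul_of_nonneg_left hpot₄' hφ']
  have hm₅ : (E₅.C'.m : ℝ) + 1 = C₄.m := by exact_mod_cast E₅.m_add_one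
  have hinf₅ : ((E₅.C'.influential R').card : ℝ) ≤ (C₄.influential R').card := by
    exact_mod_cast card_le_card (E₅.influential_subset R')
  have hμ₅ : E₅.C'.measure αφ αI αQ P₅ R' ≤ C₄.measure αφ αI αQ P₄ R' - 1 := by
    unfold measure
    nlinarith [mul_le_mul_of_nonneg_left hinf₅ hI', mul_le_mul_of_nonneg_left hpot₅ hφ']
  have hm₆ : (E₆.C'.m : ℝ) + 1 = E₅.C'.m := by exact_mod_cast E₆.m_add_one
  have hinf₆ : ((E₆.C'.influential R').card : ℝ) ≤ (E₅.C'.influential R').card := by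
    exact_mod_cast card_le_card (E₆.influential_subset R')
  have hμ₆ : E₆.C'.measure αφ αI αQ P₆ R' ≤ E₅.C'.measure αφ αI αQ P₅ R' - 1 := by
    unfold measure
    nlinarith [mul_le_mul_of_nonneg_left hinf₆ hI', mul_le_mul_of_nonneg_left hpot₆ hφ']
  have hμ₇ := E₇.measure_le
  refine Or.inr ⟨1, le_rfl, by norm_num, E₇.C', R', E₇.P', E₇.fair, E₇.computes, E₇.packing, hdim', ?_⟩
  have hδ := liYangDelta_le_five_sub αφ αI αQ
  simp only [Nat.cast_one, mul_one]
  linarith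

end Semicircuit

end Literature.Computability.Complexity
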